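import Summits.CriticalPhenomena.Ising3DConformalLimit.Theses.LeeYangGap
import Literature.Probability.LatticeModels.DirInvCorrLength
import Literature.Probability.LatticeModels.LebowitzCoexistence
import Literature.Probability.LatticeModels.CriticalTwoPointBounds

/-!
# The correlation length is unbounded below `β_c` (stub `stub_corrLengthUnbounded`)

Route `LeeYangGap` (Ising3DConformalLimit), crux `NearCriticalLeeYangGap` (item stmt-CriticalPhenomena-4945),
line `registered`, stub S1u `stub_corrLengthUnbounded`. Nearest-neighbour Ising model on `ℤ³`;
`ξ(β) = isingCorrLength 3 β = (ξ_β(e₁))⁻¹` is the plus-state axis correlation length, `ξ_β(x) =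
dirInvCorrLength 3 β x = lim_n -log⟨σ₀σ_{nx}⟩⁺_β/n` the directional inverse correlation length (mass),
`β_c = criticalBeta 3`.

**Claim.** For every `β₁ < β_c` and every `M`, there is `β ∈ [β₁, β_c)` with `ξ(β) ≥ M`.

**Proof** (every ingredient is a tree theorem). Fix a direction `e ≠ 0` and `η > 0`.
(1) At `β_c` the mass vanishes, `ξ_{β_c}(e) = 0` (`dirInvCorrLength_criticalBeta`, from the polynomial
lower bound on the critical two-point function), and `-log⟨σ₀σ_{ne}⟩⁺_{β_c}/n → ξ_{β_c}(e)`
(`tendsto_dirInvCorrLength`, Fekete), so some `n ≥ 1` has `-log⟨σ₀σ_{ne}⟩⁺_{β_c}/n < δ`, `2δ = η`.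
(2) `⟨σ₀σ_x⟩⁺_{β_c} = ⟨σ₀σ_x⟩^∅_{β_c}` in `d = 3` (`twoPointPlus_criticalBeta_eq_twoPointFree_holds`,
Aizenman–Duminil-Copin–Sidoravicius 2015), and `β ↦ ⟨σ_A⟩^∅_β` is lower semicontinuous from the left
(`eventually_lt_freeCorr_of_lt`); since `⟨σ_A⟩^∅_β ≤ ⟨σ_A⟩⁺_β` (`freeCorr_le_plusCorr`), for all
`β < β_c` close to `β_c` we get `⟨σ₀σ_{ne}⟩⁺_β > e^{-δn}⟨σ₀σ_{ne}⟩⁺_{β_c}`, i.e.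
`-log⟨σ₀σ_{ne}⟩⁺_β/n < 2δ = η`.
(3) Fekete's `lim = inf` (`dirInvCorrLength_le_div`) gives `ξ_β(e) ≤ -log⟨σ₀σ_{ne}⟩⁺_β/n < η`, and the
left-neighbourhood filter of `β_c` also allows `β > max β₁ (β_c/2)`.
Finally, with `e = e₁` and `η = 1/max(M,1)`: `ξ_β(e₁) > 0` below `β_c` (`dirInvCorrLength_pos`,
sharpness), so `ξ(β) = ξ_β(e₁)⁻¹ ≥ max(M,1) ≥ M`.

## References

* M. Campanino, D. Ioffe, Y. Velenik, PTRF 125 (2003), §1.1 and Thm. 1.1 [CampaninoIoffeVelenik2003].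
* M. Aizenman, H. Duminil-Copin, V. Sidoravicius, CMP 334 (2015), Thm. 1.2, §3.3
  [AizenmanDuminilCopinSidoraviciusCMP2015].
* S. Friedli, Y. Velenik, Statistical Mechanics of Lattice Systems (CUP 2017), §3.10.11, Lemma 3.31
  [FriedliVelenik2017].
-/

noncomputable section

namespace Summit.CriticalPhenomena.Ising3DConformalLimit.LeeYangGapNearCriticalLeeYangGap

open Literature.Probability.LatticeModels Filter Set Finset Topology

/-- **Upper semicontinuity of the directional mass from the left at `β_c` (where it vanishes)**:
for `e ≠ 0` in `ℤ³`, `β₁ < β_c` and `η > 0` there is `β ∈ [β₁, β_c)`, `β > 0`, with `ξ_β(e) < η`.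
From `ξ_{β_c}(e) = 0`, Fekete's `ξ_β(e) ≤ -log⟨σ₀σ_{ne}⟩⁺_β/n`, the lower semicontinuity from the
left of the free pair correlation, `⟨·⟩^∅ ≤ ⟨·⟩⁺`, and `⟨σ₀σ_x⟩⁺_{β_c} = ⟨σ₀σ_x⟩^∅_{β_c}` (`d = 3`). -/
theorem exists_dirInvCorrLength_lt {e : Site 3} (he : e ≠ 0) {β₁ : ℝ} (hβ₁ : β₁ < criticalBeta 3)
    {η : ℝ} (hη : 0 < η) :
    ∃ β : ℝ, β₁ ≤ β ∧ 0 < β ∧ β < criticalBeta 3 ∧ dirInvCorrLength 3 β e < η := by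
  have hβc : 0 < criticalBeta 3 := criticalBeta_pos_holds (d := 3) (by norm_num)
  obtain ⟨δ, hδ, hδη⟩ : ∃ δ : ℝ, 0 < δ ∧ 2 * δ = η := ⟨η / 2, by positivity, by ring⟩
  -- Step 1: at `β_c` the mass vanishes, so `-log ⟨σ₀σ_{ne}⟩⁺_{β_c} / n < δ` for some `n ≥ 1`.
  have hlim : Tendsto (fun n : ℕ => -Real.log (twoPointPlus 3 (criticalBeta 3) ((n : ℤ) • e)) / (n : ℝ))
      atTop (𝓝 0) := by
    have h := tendsto_dirInvCorrLength (d := 3) hβc e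
    rwa [dirInvCorrLength_criticalBeta (d := 3) (by norm_num) e] at h
  obtain ⟨n, hnlt, hn⟩ :=
    ((hlim.eventually (eventually_lt_nhds hδ)).and (eventually_ne_atTop 0)).exists
  have hn' : (0 : ℝ) < n := by exact_mod_cast Nat.pos_of_ne_zero hn
  have hx : ((n : ℤ) • e : Site 3) ≠ 0 := by
    rw [← norm_pos_iff, Site.norm_natCast_zsmul]
    exact mul_pos hn' (norm_pos_iff.2 he)
  -- `G_c := ⟨σ₀σ_{ne}⟩⁺_{β_c} > 0` and `-log G_c < δ n`
  have hGc : 0 < twoPointPlus 3 (criticalBeta 3) ((n : ℤ) • e) := twoPointPlus_pos hβc _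
  have hlogGc : -Real.log (twoPointPlus 3 (criticalBeta 3) ((n : ℤ) • e)) < δ * n := by
    have h : -Real.log (twoPointPlus 3 (criticalBeta 3) ((n : ℤ) • e)) / (n : ℝ) < δ := hnlt
    rwa [div_lt_iff₀ hn'] at h
  -- Step 2: lower semicontinuity from the left of the free pair correlation at `β_c`,
  -- with `ε := G_c (1 - e^{-δ n}) > 0`, so that `G_c - ε = G_c e^{-δ n}`.
  have hexp : Real.exp (-(δ * n)) < 1 := Real.exp_lt_one_iff.2 (neg_lt_zero.2 (mul_pos hδ hn'))
  have hε : 0 < twoPointPlus 3 (criticalBeta 3) ((n : ℤ) • e) * (1 - Real.exp (-(δ * n))) :=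
    mul_pos hGc (by linarith)
  have hfree_c : freeCorr 3 (criticalBeta 3) 0 {0, (n : ℤ) • e} =
      twoPointPlus 3 (criticalBeta 3) ((n : ℤ) • e) := by
    rw [← twoPointFree_eq_freeCorr (criticalBeta 3) hx,
      twoPointPlus_criticalBeta_eq_twoPointFree_holds (d := 3) le_rfl ((n : ℤ) • e)]
  have hev := eventually_lt_freeCorr_of_lt (d := 3) hβc ({0, (n : ℤ) • e} : Finset (Site 3)) hε
  -- Step 3: pick `β ∈ (max β₁ (β_c/2), β_c)` where the free correlation is still large.
  have hlow : max β₁ (criticalBeta 3 / 2) < criticalBeta 3 := max_lt hβ₁ (by linarith)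
  obtain ⟨β, hβfree, hβI⟩ := (hev.and (Ioo_mem_nhdsLT hlow)).exists
  have hβ₁β : β₁ ≤ β := ((le_max_left _ _).trans_lt hβI.1).le
  have hβpos : 0 < β := (half_pos hβc).trans ((le_max_right _ _).trans_lt hβI.1)
  have hββc : β < criticalBeta 3 := hβI.2
  refine ⟨β, hβ₁β, hβpos, hββc, ?_⟩
  -- Step 4: `⟨σ₀σ_{ne}⟩⁺_β ≥ ⟨σ₀σ_{ne}⟩^∅_β > G_c e^{-δ n}`, so `-log ⟨σ₀σ_{ne}⟩⁺_β < 2 δ n`.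
  have hG' : twoPointPlus 3 (criticalBeta 3) ((n : ℤ) • e) * Real.exp (-(δ * n)) <
      twoPointPlus 3 β ((n : ℤ) • e) := by
    have h1 : freeCorr 3 β 0 {0, (n : ℤ) • e} ≤ twoPointPlus 3 β ((n : ℤ) • e) := by
      rw [twoPointPlus_eq_plusCorr β hx]
      exact freeCorr_le_plusCorr hβpos.le le_rfl _
    rw [hfree_c] at hβfree
    linarith [hβfree, h1]
  have hGexp : 0 < twoPointPlus 3 (criticalBeta 3) ((n : ℤ) • e) * Real.exp (-(δ * n)) :=
    mul_pos hGc (Real.exp_pos _)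
  have hlogG' : -Real.log (twoPointPlus 3 β ((n : ℤ) • e)) < 2 * δ * n := by
    have h := Real.log_le_log hGexp hG'.le
    rw [Real.log_mul hGc.ne' (Real.exp_pos _).ne', Real.log_exp] at h
    linarith
  -- Step 5: Fekete's `lim = inf` bound.
  have hmass_le : dirInvCorrLength 3 β e ≤ -Real.log (twoPointPlus 3 β ((n : ℤ) • e)) / (n : ℝ) :=
    dirInvCorrLength_le_div hβpos e hn
  have h1 : -Real.log (twoPointPlus 3 β ((n : ℤ) • e)) / (n : ℝ) < 2 * δ := by
    rw [div_lt_iff₀ hn']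
    linarith
  linarith

/-- **S1u `stub_corrLengthUnbounded`: the correlation length is unbounded on `[β₁, β_c)`.** For the
nearest-neighbour Ising model on `ℤ³`, every `β₁ < β_c(3)` and every `M : ℝ` admit `β ∈ [β₁, β_c(3))`
with `M ≤ ξ(β) = isingCorrLength 3 β`. Proof: `ξ(β) = ξ_β(e₁)⁻¹` (`isingCorrLength_eq_inv_dirInvCorrLength`),
`0 < ξ_β(e₁)` below `β_c` (sharpness, `dirInvCorrLength_pos`) and `ξ_β(e₁) < 1/max(M,1)` for some
`β ∈ [β₁, β_c)`, `β > 0` (`exists_dirInvCorrLength_lt`: the mass vanishes at `β_c` and is upper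
semicontinuous from the left there). -/
theorem stub_corrLengthUnbounded :
    ∀ β₁ M : ℝ, β₁ < Literature.Probability.LatticeModels.criticalBeta 3 →
      ∃ β : ℝ, β₁ ≤ β ∧ β < Literature.Probability.LatticeModels.criticalBeta 3 ∧
        M ≤ Literature.Probability.LatticeModels.isingCorrLength 3 β := by
  intro β₁ M hβ₁
  obtain ⟨M', hMM', hM'1⟩ : ∃ M' : ℝ, M ≤ M' ∧ 1 ≤ M' := ⟨max M 1, le_max_left _ _, le_max_right _ _⟩
  have hM'pos : 0 < M' := one_pos.trans_le hM'1
  have he₁ : (Pi.single 0 1 : Site 3) ≠ 0 := by simp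
  obtain ⟨β, hβ₁β, hβpos, hββc, hmass⟩ :=
    exists_dirInvCorrLength_lt he₁ hβ₁ (inv_pos.2 hM'pos)
  have hmass_pos : 0 < dirInvCorrLength 3 β (Pi.single 0 1) :=
    dirInvCorrLength_pos (d := 3) (by norm_num) hβpos hββc he₁
  refine ⟨β, hβ₁β, hββc, ?_⟩
  rw [isingCorrLength_eq_inv_dirInvCorrLength hβpos.le]
  exact hMM'.trans ((le_inv_comm₀ hM'pos hmass_pos).2 hmass.le)

end Summit.CriticalPhenomena.Ising3DConformalLimit.LeeYangGapNearCriticalLeeYangGap
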